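import Summits.Ventures.Crystal3D.Bulk.GapKite
import HarnessLib

/-!
# The kite map (K) of L3P as kernel identities: in a P-kite the pair row forces the FAR side, so
# `cos |pb| = (D − √((2G+1)(2G+2−D²)))/(2G+2)` with `G = cos d = ⟪u_a, u_e⟫`, and every corner is
# an explicit function of `d` — for every admissible configuration, no convexity premise

HONEST FRAMING. Part of the venture `Summits/Ventures/Crystal3D` (cell `pub-crystal3d`, phase 2;
seat p2, PROMOTION-AUDIT prep). Kernel theorems about an ADMISSIBLE fourteen-ball configuration
`c` (`IsGapConfig c`; no extremality, NO convexity / face hypothesis); nothing here asserts anything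
about GAP(1.26), books or replays a kill, or moves a census number. Purpose (memo
`HOME/audit/PROMOTION-AUDIT-memo.md` A6 (3) «L3P (K)(P)(H) parametrisation completeness … ×1
A-internal»): L3P v2.7 (`phase2/ENV-CENSUS/impla/l3p/L3P-METHOD.md` §2 (K)) bounds the corners of a
P-KITE `(p, a, b, c)` — sides `(ρ, 60, 60, ρ)`: the intruder `p` tight to `a, c`, the shell ball `b`
tight to `a, c` — through the map
«`d := |ac|`: `cos d = cos²ρ + sin²ρ cos u_p`; convexity ⇒ `u_a = u_c = β + γ`,
`cos β = cot ρ tan(d/2)`, `cos γ = tan(d/2)/√3`; `cos u_b = (cos d − 1/4)/(3/4)`; `p` and `b` on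
opposite sides of `ac` ⇒ `|pb| = h_p + h_b`, `cos h_p = cos ρ/cos(d/2)`, `cos h_b = (1/2)/cos(d/2)`;
constraint `|pb| ≥ ρ`». With `G := ⟪u_a, u_c⟫ = cos d`, `y := ⟪u_b, p̂⟫ = cos |pb|`, `D = 2 cos ρ`
the tree already has: `cos u_p = (G − D²/4)/(1 − D²/4)` (`IsGapConfig.cos_hole_corner`,
`Bulk/GapKiteHoleCorner.lean`, a sibling file — not imported here); `cos u_b = (4G − 1)/3` (`IsGapConfig.cos_corner_rhombus`,
`Bulk/GapRhombus.lean`); `u_a = u_c` (`IsGapConfig.kite_corner_eq`) and the closure relation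
`2(1 − y²)(G + 1/2) = (D − y)²` (`IsGapConfig.kite_diag_relation`, `Bulk/GapKite.lean`), whose two
roots in `y` are the two positions of `b` (far / near side of `ac`); and `|pb| ≥ ρ ⇒ u_p ≤ 2A_p`
(`IsGapConfig.hole_corner_kite_le`). THIS file closes the map:

* **`IsGapConfig.inner_shell_hole_of_kite`** — THE FAR SIDE IS FORCED BY THE PAIR ROW, not by
  convexity: with `D² < 2`, the pair row `y ≤ D/2` excludes the larger root, so
  `2(G+1)·y = D − √((2G+1)(2G+2−D²))`, i.e. `cos |pb| = cos h_p cos h_b − sin h_p sin h_b`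
  EXACTLY (`cos h_p cos h_b = D/(2(G+1))`, `sin h_p sin h_b = √((2G+1)(2G+2−D²))/(2(G+1))` with
  `cos²(d/2) = (1+G)/2` — L3P's `|pb| = h_p + h_b` as a kernel identity);
* **`IsGapConfig.cos_corner_shell_hole`** — law of cosines at a shell ball between the hole and a
  shell contact: `cos (corner c a 13 b) = (y − D/4)/((√3/2)·√(1 − D²/4))` (general; in the kite it
  makes `u_a` an explicit function of `d` through the first bullet; L3P's `β + γ` is the same
  number: `cos β cos γ − sin β sin γ` with the printed `cos β, cos γ` reduces, by
  `tan²(d/2) = (1−G)/(1+G)`, `4 sin²ρ = 4 − D²`, to `(y − D/4)/((√3/2) sin ρ)` with `y` the far-side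
  root — a half-angle identity written out in the seat memo `phase2/p2-rows/g16/ENDPOINTS-KERNEL-p2-g16.md`
  §r10, not a premise about configurations);
* **`IsGapConfig.kite_far_root_gt`** (the excluded root): `(D + √((2G+1)(2G+2−D²)))/(2(G+1)) > D/2`.

So for KITES the (K) map's relations hold for EVERY admissible configuration from the pair rows
alone; what stays OUTSIDE the kernel for (K) is only L3P's interval EVALUATION of these closed forms
on boxes (mpmath.iv, grid tables) — and for (P)/(H) the fan decompositions (convexity), dossier
F-A5.
-/

noncomputable section

open scoped BigOperators InnerProductSpace
open Finset Real

namespace Summit.Ventures.Crystal3D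

open Literature.Geometry.DiscreteGeometry InnerProductGeometry

variable {c : Fin 14 → EuclideanSpace ℝ (Fin 3)}

/-- **The near-side root is excluded on the window** (auxiliary form): for `D² < 2`, `0 < D` and
`−1 < G`, `D·G < √((2G+1)(2G+2−D²))` (trivial for `G < 0`; for `G ≥ 0`:
`S − D²G² = G²(4 − D²) + G(6 − 2D²) + (2 − D²) > 0`). [folklore] -/
theorem kite_far_root_aux {D G : ℝ} (hD0 : 0 < D) (hD2 : D ^ 2 < 2) (hG : -1 < G) :
    D * G < Real.sqrt ((2 * G + 1) * (2 * G + 2 - D ^ 2)) := by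
  by_cases hG0 : G < 0
  · exact lt_of_lt_of_le (mul_neg_of_pos_of_neg hD0 hG0) (Real.sqrt_nonneg _)
  · push Not at hG0
    have hDG : 0 ≤ D * G := by positivity
    rw [show D * G = Real.sqrt ((D * G) ^ 2) by rw [Real.sqrt_sq hDG]]
    apply Real.sqrt_lt_sqrt (sq_nonneg _)
    nlinarith [mul_nonneg hG0 hG0, mul_nonneg hG0 hD0.le, sq_nonneg G, hG]

/-- **L3P's `|pb| = h_p + h_b` as a kernel identity; the far side is forced by the pair row.**
For an admissible configuration with `D² < 2`, a P-kite — shell balls `a ≠ e` touching the intruder,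
a shell ball `b` touching `a` and `e` — satisfies, with `G = ⟪u_a, u_e⟫` and `y = ⟪u_b, p̂⟫`:
`2(G+1)·y = D − √((2G+1)(2G+2−D²))`. (From `kite_diag_relation`: `(2(G+1)y − D)² =
(2G+1)(2G+2−D²)`; the `+` root has `y > D/2`, contradicting the pair row `⟪u_b, p̂⟫ ≤ D/2`.)
[folklore] -/
theorem IsGapConfig.inner_shell_hole_of_kite (hc : IsGapConfig c) (hD2 : intruderDist c ^ 2 < 2)
    {a e b : Fin 14} (ha0 : a ≠ 0) (ha13 : a ≠ 13) (he0 : e ≠ 0) (he13 : e ≠ 13) (hb0 : b ≠ 0)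
    (hb13 : b ≠ 13) (hae : a ≠ e) (ha : dist (c a) (c 13) = 1) (he : dist (c e) (c 13) = 1)
    (hba : dist (c b) (c a) = 1) (hbe : dist (c b) (c e) = 1) :
    2 * (⟪gapDir c a, gapDir c e⟫_ℝ + 1) * ⟪gapDir c b, gapDir c 13⟫_ℝ =
      intruderDist c - Real.sqrt ((2 * ⟪gapDir c a, gapDir c e⟫_ℝ + 1) *
        (2 * ⟪gapDir c a, gapDir c e⟫_ℝ + 2 - intruderDist c ^ 2)) := by
  set D := intruderDist c with hDdef
  set G := ⟪gapDir c a, gapDir c e⟫_ℝ with hGdef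
  set y := ⟪gapDir c b, gapDir c 13⟫_ℝ with hydef
  have hD1 : 1 ≤ D := hc.one_le_intruderDist
  have hD : D < 2 := by nlinarith
  have h13 : (13 : Fin 14) ≠ 0 := by decide
  -- closure relation and pair row
  have hrel := hc.kite_diag_relation hD ha0 ha13 hb0 hb13 he0 he13 hae
    (by rw [dist_comm]; exact hba) hbe ha he
  rw [← hydef, ← hGdef, ← hDdef] at hrel
  have hrow : y ≤ D / 2 := by
    have h := hc.inner_gapDir_le hb0 h13 hb13
    rw [tightLevel_of_right] at h
    exact h
  -- `G ≥ −1/2 > −1`: `u_a`, `u_e` are both at `60°` from `u_b` (Cauchy–Schwarz for `u_b`, `u_a + u_e`)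
  have hG : -1 < G := by
    have hba' : ⟪gapDir c b, gapDir c a⟫_ℝ = 1 / 2 := by
      rw [hc.inner_gapDir_eq hb0 ha0 hba, tightLevel_of_ne hb13 ha13]
    have hbe' : ⟪gapDir c b, gapDir c e⟫_ℝ = 1 / 2 := by
      rw [hc.inner_gapDir_eq hb0 he0 hbe, tightLevel_of_ne hb13 he13]
    have hbb : ⟪gapDir c b, gapDir c b⟫_ℝ = 1 := by
      rw [real_inner_self_eq_norm_sq, hc.norm_gapDir hb0, one_pow]
    have haa : ⟪gapDir c a, gapDir c a⟫_ℝ = 1 := by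
      rw [real_inner_self_eq_norm_sq, hc.norm_gapDir ha0, one_pow]
    have hee : ⟪gapDir c e, gapDir c e⟫_ℝ = 1 := by
      rw [real_inner_self_eq_norm_sq, hc.norm_gapDir he0, one_pow]
    have hea : ⟪gapDir c e, gapDir c a⟫_ℝ = G := by rw [real_inner_comm]
    have hcs := real_inner_mul_inner_self_le (gapDir c b) (gapDir c a + gapDir c e)
    have e1 : ⟪gapDir c b, gapDir c a + gapDir c e⟫_ℝ = 1 := by
      rw [inner_add_right, hba', hbe']; norm_num
    have e2 : ⟪gapDir c a + gapDir c e, gapDir c a + gapDir c e⟫_ℝ = 2 + 2 * G := by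
      rw [inner_add_left, inner_add_right, inner_add_right, haa, hee, hea, ← hGdef]; ring
    rw [e1, hbb, e2] at hcs
    linarith
  -- `(2(G+1)y − D)² = S`
  set S := (2 * G + 1) * (2 * G + 2 - D ^ 2) with hS
  have hsq : (2 * (G + 1) * y - D) ^ 2 = S := by
    rw [hS]; linear_combination (-2 * (G + 1)) * hrel
  have hS0 : 0 ≤ S := by rw [← hsq]; exact sq_nonneg _
  -- the two roots; exclude `+`
  have hroot : 2 * (G + 1) * y - D = Real.sqrt S ∨ 2 * (G + 1) * y - D = -Real.sqrt S := by
    rcases lt_trichotomy (2 * (G + 1) * y - D) 0 with hlt | heq | hgt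
    · right
      have : Real.sqrt S = -(2 * (G + 1) * y - D) := by
        rw [← hsq, Real.sqrt_sq_eq_abs, abs_of_neg hlt]
      linarith
    · have hS' : S = 0 := by rw [← hsq, heq]; ring
      left; rw [heq, hS', Real.sqrt_zero]
    · left
      rw [← hsq, Real.sqrt_sq_eq_abs, abs_of_pos hgt]
  rcases hroot with hplus | hminus
  · -- `+` root: `2(G+1)y = D + √S > D + DG = D(G+1)` ⇒ `y > D/2`, contradiction
    exfalso
    have haux := kite_far_root_aux (by linarith) hD2 hG
    have h1 : 2 * (G + 1) * y = D + Real.sqrt S := by linarith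
    have h2 : 2 * (G + 1) * y ≤ 2 * (G + 1) * (D / 2) :=
      mul_le_mul_of_nonneg_left hrow (by linarith)
    nlinarith
  · show 2 * (G + 1) * y = D - Real.sqrt S
    linarith

/-- **The excluded root exceeds `D/2`** (the near-side position of `b`, `|pb| = h_b − h_p < ρ`):
for `D² < 2`, `0 < D` and `−1 < G`,
`D/2 < (D + √((2G+1)(2G+2−D²)))/(2(G+1))`. [folklore] -/
theorem kite_far_root_gt {D G : ℝ} (hD0 : 0 < D) (hD2 : D ^ 2 < 2) (hG : -1 < G) :
    D / 2 < (D + Real.sqrt ((2 * G + 1) * (2 * G + 2 - D ^ 2))) / (2 * (G + 1)) := by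
  have h := kite_far_root_aux hD0 hD2 hG
  rw [lt_div_iff₀ (by linarith)]
  nlinarith

/-- **Law of cosines at a shell ball between the hole and a shell contact** (the tree's two-level
tangent formula at levels `D/2` and `1/2`): for a shell ball `a` touching the intruder and the shell
ball `b`, `cos (corner c a 13 b) = (⟪u_b, p̂⟫ − D/4)/(√(1 − D²/4) · (√3/2))`. In a P-kite this makes
`u_a` (`= u_c`, `kite_corner_eq`) an explicit function of `d` through
`IsGapConfig.inner_shell_hole_of_kite`. [folklore] -/
theorem IsGapConfig.cos_corner_shell_hole (hc : IsGapConfig c) {a b : Fin 14} (ha0 : a ≠ 0) (ha13 : a ≠ 13) (hb0 : b ≠ 0) (hb13 : b ≠ 13)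
    (ha : dist (c a) (c 13) = 1) (hab : dist (c a) (c b) = 1) :
    Real.cos (corner c a 13 b) =
      (⟪gapDir c b, gapDir c 13⟫_ℝ - intruderDist c / 4) /
        (Real.sqrt (1 - intruderDist c ^ 2 / 4) * (Real.sqrt 3 / 2)) := by
  set D := intruderDist c with hDdef
  have hD1 : 1 ≤ D := hc.one_le_intruderDist
  have h13 : (13 : Fin 14) ≠ 0 := by decide
  have hap : ⟪gapDir c a, gapDir c 13⟫_ℝ = D / 2 := by
    rw [hc.inner_gapDir_eq ha0 h13 ha, tightLevel_of_right]
  have hab' : ⟪gapDir c a, gapDir c b⟫_ℝ = 1 / 2 := by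
    rw [hc.inner_gapDir_eq ha0 hb0 hab, tightLevel_of_ne ha13 hb13]
  have hpb : ⟪gapDir c 13, gapDir c b⟫_ℝ = ⟪gapDir c b, gapDir c 13⟫_ℝ := real_inner_comm _ _
  unfold corner
  rw [InnerProductGeometry.cos_angle,
    norm_tangentProj_eq_sqrt (hc.norm_gapDir ha0) (hc.norm_gapDir h13) hap,
    norm_tangentProj_eq_sqrt (hc.norm_gapDir ha0) (hc.norm_gapDir hb0) hab',
    inner_tangentProj_eq_twoLevel (hc.norm_gapDir ha0) hap hab' hpb, sqrt_one_sub_half_sq]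
  have e1 : (1:ℝ) - (D / 2) ^ 2 = 1 - D ^ 2 / 4 := by ring
  rw [e1]
  congr 1; ring

end Summit.Ventures.Crystal3D
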